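/-
Copyright (c) 2026 the pub-hodgecm-mathlib formalisation cell (harness21).  Prover seat hodgecm-mathlib-K2E4-p10 (g9), Track B «K2-LIT»,
#184♮ = hLiu418 = `stmt-HodgeConjecture-24832`; socket #41, KIND W, (x-b) of LEAD F0P6-plan (g14) BATCH #62 (1) + desk K2E5-p17 (g8) RULING 2026-09-04T22:15:21Z;
FILE 2b of this seat's (x-b) chain (★ p862446 `K2LiuSiegelEisensteinKindWInstance` §1 `hsupp_of_local`, `K2LiuSiegelEisensteinKindWDecay` `hdec_of_letters`).
THEOREMS ONLY (no `def`, no `instance`, no notation, no named-fact hypothesis, no `sorry`).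
-/
import Summits.HodgeConjecture.HodgeConjecture.Theorems.K2LiuIwasawaHeightLatticeSumBound     -- ★ G7-C: `block_entry_bounds`, `exists_adelicHeightGL_floor`, `detFactor_le_height` (+ ★ G7-B, G7-A)
import HarnessLib

/-!
# Crux `HLiu418`, socket #41, KIND W — `K2LiuSiegelEisensteinKindWArchDecay`: THE POINTWISE ARCHIMEDEAN DECAY FACE AGAINST THE HEIGHT
# `∏_σ e^{−2π Re tr(x_σ · y_σ y_σᴴ)} ≤ e^{−c ‖h‖^{−2} Σ_σ Re tr x_σ}` for every index `x_σ ⪰ 0` and ANY block decomposition of `h_∞`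

Cell `hodgecm-mathlib`, crux item hLiu418 = `stmt-HodgeConjecture-24832` (helper lane `--supports … --as helper`, count-neutral), route of record `HCCMUnconditional`;
squad K2 ∕ K2Liu, road `K2_Liu`, socket #41 `sig_K2LiuSiegelEisensteinContinuation`, KIND W.  The TOP of record (★ ed. 16 `K2LiuSiegelEisensteinContinuationTopSixteen`,
KIND-W block = ed. 15 :176–196) asks for the height-form Gaussian DECAY letter `hdec`: `‖A S s h‖ ≤ C ‖h‖^a · e^{−c ‖h‖^{−a′} τ(S)} (1 + τ S)^{N_W}`, POINTWISE in the
Fourier index `S`.  Its archimedean source is the three-factor growth of the continued local Whittaker function (★ JUNCTION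
`K2LiuKFiniteSectionWhittakerHolomorphyGrowth`: `C e^{−π tr h′}(1+tr h′)^N(1+det h′^{−N′})` at the Iwasawa-normalised index `h′ = y_σᴴ S_σ y_σ`, so
`tr h′ = Re tr(S_σ · y_σ y_σᴴ)`).  ★ G7-C `K2LiuIwasawaHeightLatticeSumBound` turns this into the height currency for the SUMMED lattice majorant Φ9-CORE consumes
(`latticeSum_le_height`) and for the determinant factor (`detFactor_le_height`, pointwise); THIS FILE is the missing POINTWISE DECAY twin, in the SAME by-value
frame currency (complex places `w σ` fixed by `c ≠ 1`, `r : p ⊕ p ≃ Fin N`, frames `T σ, T σ⁻¹` and movers `κ σ, κ′ σ` with entries `≤ M`, ANY block decomposition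
`hdec : T σ · (h_∞)~_{w σ} · T σ⁻¹ = [y σ, b σ; 0, d σ] · κ σ`):
* §1 `exp_prod_le_of_cone` — the cone step summed over the places: `y_σ y_σᴴ ⪰ ε•1` and `x_σ ⪰ 0` give `∏_σ e^{−2π Re tr(x_σ y_σ y_σᴴ)} ≤ e^{−2π ε Σ_σ Re tr x_σ}`
  (★ G7-A `mul_re_trace_le_re_trace_mul`);
* §2 **`decay_le_exp_neg_height`** — THE FACE: `∃ c > 0` (frame data only) with, for every `h`, every block decomposition and every `x : S → M_p(ℂ)` with all
  `x σ ⪰ 0`:  `∏_σ e^{−2π Re tr(x_σ · y_σ y_σᴴ)} ≤ e^{−c · ‖h‖^{−2} · Σ_σ Re tr x_σ}` (★ G7-B `block_entry_bounds` + `posSemidef_mul_conjTranspose_sub_smul`: `ε(h)⁻¹ ≤ c_E² ‖h‖²`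
  with the height floor ★ `exists_adelicHeightGL_floor`);  `decay_le_exp_neg_height_of_le` — the same against any `τ ≤ Σ_σ Re tr x_σ` (the TOP's `τ S`, since the
  embedded entries of a positive index are below its traces);
* §3 `prod_one_add_trace_pow_le` — the polynomial factor: `∏_σ (1 + Re tr x_σ)^{N} ≤ (1 + Σ_σ Re tr x_σ)^{N·#S}`.
With ★ `detFactor_le_height` these are the three archimedean conversions the per-place → `hdec` assembly (★ `K2LiuSiegelEisensteinKindWDecay.hdec_of_letters`) needs.
[MoeglinWaldspurger1995, I.2.2, II.1.5, IV.1.9], [BorelJacquet1979, §1.2, §4.1], [Shimura1997, §A3, §18.4], [Shimura1982, Thm. 3.1].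
HONEST LABEL.  Count-neutral helper, closes no socket: `HC_CM` is proved only modulo the 7 printed citations (2 remaining named inputs: hLiu418 =
`stmt-HodgeConjecture-24832`, h413 = `stmt-HodgeConjecture-24833`) until rung 0 closes.
-/

set_option autoImplicit false
set_option linter.dupNamespace false -- the mandated namespace repeats `HodgeConjecture.HodgeConjecture`

noncomputable section

open scoped BigOperators ComplexOrder Matrix
-- `Classical` is needed to see the Mathlib normed-ring instances on `mixedSpace E` (note H5 of `AdelicGLnGlue`)
open scoped Classical
open Finset

namespace Summit.HodgeConjecture.HodgeConjecture.Cruxes.HLiu418.K2LiuSiegelEisensteinKindWArchDecay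

open Summit.HodgeConjecture.HodgeConjecture.Cruxes.HLiu418.K2LiuArchBlockHeightBound
open Summit.HodgeConjecture.HodgeConjecture.Cruxes.HLiu418.K2LiuLatticeExpDecaySumBound (mul_re_trace_le_re_trace_mul)
open Summit.HodgeConjecture.HodgeConjecture.Cruxes.HLiu418.K2LiuIwasawaHeightLatticeSumBound (block_entry_bounds exists_adelicHeightGL_floor)

/-! ## §1 The cone step, summed over the places -/

section Cone

variable {S p : Type*} [Fintype S] [Fintype p] [DecidableEq p]

/-- **THE CONE STEP OVER THE PLACES**: if every `x σ ⪰ 0` and every `Y σ − ε•1 ⪰ 0`, then `∏_σ e^{−2π Re tr(x_σ Y_σ)} ≤ e^{−2π ε Σ_σ Re tr x_σ}`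
(★ G7-A `mul_re_trace_le_re_trace_mul` place by place, `exp` monotone, `∏ exp = exp Σ`). [cite: Shimura1997, §A3] -/
theorem exp_prod_le_of_cone (x Y : S → Matrix p p ℂ) (hx : ∀ σ, (x σ).PosSemidef) {ε : ℝ}
    (hY : ∀ σ, (Y σ - (ε : ℂ) • (1 : Matrix p p ℂ)).PosSemidef) :
    ∏ σ, Real.exp (-(2 * Real.pi * ((x σ * Y σ).trace).re)) ≤ Real.exp (-(2 * Real.pi * ε * ∑ σ, ((x σ).trace).re)) := by
  rw [← Real.exp_sum, Real.exp_le_exp, Finset.mul_sum, ← Finset.sum_neg_distrib]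
  refine Finset.sum_le_sum fun σ _ => ?_
  have h := mul_re_trace_le_re_trace_mul (hx σ) (hY σ)
  nlinarith [Real.pi_pos]

omit [DecidableEq p] in
/-- **the polynomial factor**: `∏_σ (1 + Re tr x_σ)^{N} ≤ (1 + Σ_σ Re tr x_σ)^{N·#S}` when every `Re tr x_σ ≥ 0` (e.g. `x σ ⪰ 0`). [folklore] -/
theorem prod_one_add_trace_pow_le (x : S → Matrix p p ℂ) (hx : ∀ σ, 0 ≤ ((x σ).trace).re) (N : ℕ) :
    ∏ σ, (1 + ((x σ).trace).re) ^ N ≤ (1 + ∑ σ, ((x σ).trace).re) ^ (N * Fintype.card S) := by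
  have hle : ∀ σ ∈ (Finset.univ : Finset S), (1 + ((x σ).trace).re) ^ N ≤ (1 + ∑ σ', ((x σ').trace).re) ^ N := fun σ _ =>
    pow_le_pow_left₀ (by linarith [hx σ]) (by linarith [Finset.single_le_sum (fun σ' _ => hx σ') (Finset.mem_univ σ)]) N
  calc ∏ σ, (1 + ((x σ).trace).re) ^ N ≤ ∏ _σ : S, (1 + ∑ σ', ((x σ').trace).re) ^ N :=
        Finset.prod_le_prod (fun σ _ => pow_nonneg (by linarith [hx σ]) _) hle
    _ = (1 + ∑ σ, ((x σ).trace).re) ^ (N * Fintype.card S) := by rw [Finset.prod_const, Finset.card_univ, ← pow_mul]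

omit [Fintype S] [DecidableEq p] in
/-- the traces of positive semidefinite indices are non-negative. [folklore] -/
theorem re_trace_nonneg_of_posSemidef {x : Matrix p p ℂ} (hx : x.PosSemidef) : 0 ≤ (x.trace).re :=
  (Complex.nonneg_iff.1 hx.trace_nonneg).1

end Cone

/-! ## §2 The pointwise decay face against the height -/

section Face

open NumberField NumberField.mixedEmbedding NumberField.InfinitePlace IsDedekindDomain
open Literature.NumberTheory.Automorphic Literature.NumberTheory.Automorphic.UnitaryGroup

variable (F E : Type) [Field F] [NumberField F] [Field E] [NumberField E] [Algebra F E] (c : E ≃ₐ[F] E) (N : ℕ) (J : Matrix (Fin N) (Fin N) E)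
variable {S p : Type*} [Fintype S] [Fintype p] [DecidableEq p]

/-- **THE POINTWISE DECAY FACE AGAINST THE HEIGHT.**  Frame data BY VALUE as in ★ G7-C `latticeSum_le_height`: complex places `w σ` fixed by `c ≠ 1`,
`r : p ⊕ p ≃ Fin N` (`N ≥ 1`, `p` nonempty), frames `T σ, T σ⁻¹` and one bound `M ≥ 1` for the entries of the frames and the movers.  CONCLUSION: `∃ c > 0` (frame data
only) such that for every `h`, all movers `κ σ κ′ σ = 1 = κ′ σ κ σ` of entries `≤ M`, EVERY block decomposition `hdec : T σ · (h_∞)~_{w σ} · T σ⁻¹ = [y σ, b σ; 0, d σ] · κ σ`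
and every index `x : S → M_p(ℂ)` with all `x σ ⪰ 0`:
  `∏_σ e^{−2π Re tr(x_σ · y_σ y_σᴴ)} ≤ e^{−c · ‖h‖^{−2} · Σ_σ Re tr x_σ}`.
(`y_σ y_σᴴ ⪰ ε(h)•1` with `ε(h)⁻¹ = (|p|(c_B‖h‖+1))² ≤ c_E² ‖h‖²` by ★ G7-B and the height floor, then §1.) [cite: MoeglinWaldspurger1995, I.2.2, II.1.5]
[cite: BorelJacquet1979, §1.2, §4.1] [cite: Shimura1997, §A3] -/
theorem decay_le_exp_neg_height [NeZero N] [Nonempty p] (hc : c ≠ 1) (w : S → {w : InfinitePlace E // IsComplex w}) (hw : ∀ σ, c • (w σ).1 = (w σ).1)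
    (r : p ⊕ p ≃ Fin N) (T Tinv : S → Matrix (p ⊕ p) (p ⊕ p) ℂ) (hT : ∀ σ, T σ * Tinv σ = 1) (hT' : ∀ σ, Tinv σ * T σ = 1)
    {M : ℝ} (hM : 1 ≤ M) (hTe : ∀ σ i j, ‖T σ i j‖ ≤ M) (hTe' : ∀ σ i j, ‖Tinv σ i j‖ ≤ M) :
    ∃ c₁ : ℝ, 0 < c₁ ∧ ∀ (h : (adelicGroupData F E c N J).Adelic) (y b d : S → Matrix p p ℂ) (κ κ' : S → Matrix (p ⊕ p) (p ⊕ p) ℂ),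
      (∀ σ, κ σ * κ' σ = 1) → (∀ σ, κ' σ * κ σ = 1) → (∀ σ i j, ‖κ σ i j‖ ≤ M) → (∀ σ i j, ‖κ' σ i j‖ ≤ M) →
      (∀ σ, T σ * Matrix.reindex r.symm r.symm
          ((((archAt F E c N J (w σ) (hw σ) hc (archPart F E c N J h) : archLocal E N J (w σ)) : GL (Fin N) ℂ) : Matrix (Fin N) (Fin N) ℂ)) *
          Tinv σ = Matrix.fromBlocks (y σ) (b σ) 0 (d σ) * κ σ) →
      ∀ x : S → Matrix p p ℂ, (∀ σ, (x σ).PosSemidef) →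
        ∏ σ, Real.exp (-(2 * Real.pi * ((x σ * (y σ * (y σ)ᴴ)).trace).re)) ≤
          Real.exp (-(c₁ * adelicHeightGL N E (adelicVal F E c N J h) ^ (-(2 : ℝ)) * ∑ σ, ((x σ).trace).re)) := by
  obtain ⟨c₀, hc₀, hfloor⟩ := exists_adelicHeightGL_floor E N
  -- constants (as in ★ G7-C `latticeSum_le_height`)
  set cB : ℝ := (Fintype.card (p ⊕ p) : ℝ) ^ 3 * M ^ 3 with hcB
  have hcB0 : 0 ≤ cB := by positivity
  set cE : ℝ := (Fintype.card p : ℝ) * (cB + c₀⁻¹) with hcE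
  have hp1 : (1 : ℝ) ≤ Fintype.card p := by exact_mod_cast Fintype.card_pos
  have hcEpos : 0 < cE := by positivity
  refine ⟨2 * Real.pi * (cE ^ 2)⁻¹, by positivity, fun h y b d κ κ' hκ hκ' hκe hκe' hdec x hx => ?_⟩
  set H : ℝ := adelicHeightGL N E (adelicVal F E c N J h) with hH
  have hHc : c₀ ≤ H := hfloor _
  have hH0 : 0 < H := lt_of_lt_of_le hc₀ hHc
  have hM0 : 0 ≤ M := zero_le_one.trans hM
  -- per place: entries of `y σ`, `(y σ)⁻¹` and the floor `y yᴴ ⪰ ε•1`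
  have hblk : ∀ σ, (∀ i j, ‖y σ i j‖ ≤ cB * H) ∧ (∀ i j, ‖(y σ)⁻¹ i j‖ ≤ cB * H) ∧ y σ * (y σ)⁻¹ = 1 := by
    intro σ
    have hg := norm_archAt_archPart_apply_le F E c N J (w σ) (hw σ) hc h
    have hmul : ((((archAt F E c N J (w σ) (hw σ) hc (archPart F E c N J h) : archLocal E N J (w σ)) : GL (Fin N) ℂ) : Matrix (Fin N) (Fin N) ℂ)) *
        ((((archAt F E c N J (w σ) (hw σ) hc (archPart F E c N J h))⁻¹ : archLocal E N J (w σ)) : GL (Fin N) ℂ) : Matrix (Fin N) (Fin N) ℂ) = 1 := by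
      rw [Subgroup.coe_inv, Matrix.coe_units_inv, Matrix.mul_nonsing_inv _ (Matrix.isUnits_det_units _)]
    exact block_entry_bounds r (hT σ) (hT' σ) (hκ σ) (hκ' σ) hM0 (hTe σ) (hTe' σ) (hκe σ) (hκe' σ) hmul hH0.le
      (fun i j => (hg i j).1) (fun i j => (hg i j).2) (hdec σ)
  -- the decay rate `ε = (|p| (cB H + 1))⁻²`
  set R : ℝ := cB * H + 1 with hR
  set ε : ℝ := ((((Fintype.card p : ℝ) * R) ^ 2)⁻¹) with hε
  have hR0 : 0 < R := by rw [hR]; nlinarith [mul_nonneg hcB0 hH0.le]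
  have hε0 : 0 < ε := by positivity
  have hg : ∀ σ, (y σ * (y σ)ᴴ - (ε : ℂ) • (1 : Matrix p p ℂ)).PosSemidef := fun σ =>
    posSemidef_mul_conjTranspose_sub_smul (hblk σ).2.2 fun i j => ((hblk σ).2.1 i j).trans (by rw [hR]; linarith)
  -- §1, then `ε ≥ cE⁻² H⁻²`
  refine (exp_prod_le_of_cone x (fun σ => y σ * (y σ)ᴴ) hx hg).trans ?_
  rw [Real.exp_le_exp]
  have hsum0 : 0 ≤ ∑ σ, ((x σ).trace).re := Finset.sum_nonneg fun σ _ => re_trace_nonneg_of_posSemidef (hx σ)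
  have hinv : ε⁻¹ ≤ cE ^ 2 * H ^ 2 := by
    rw [hε, inv_inv]
    have h1 : (Fintype.card p : ℝ) * R ≤ cE * H := by
      rw [hcE, hR]
      have h3 : 1 ≤ c₀⁻¹ * H := by rw [inv_mul_eq_div, le_div_iff₀ hc₀]; linarith
      have h2 : cB * H + 1 ≤ (cB + c₀⁻¹) * H := by nlinarith
      calc (Fintype.card p : ℝ) * (cB * H + 1) ≤ (Fintype.card p : ℝ) * ((cB + c₀⁻¹) * H) :=
            mul_le_mul_of_nonneg_left h2 (Nat.cast_nonneg _)
        _ = (Fintype.card p : ℝ) * (cB + c₀⁻¹) * H := by ring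
    calc ((Fintype.card p : ℝ) * R) ^ 2 ≤ (cE * H) ^ 2 := pow_le_pow_left₀ (by positivity) h1 2
      _ = cE ^ 2 * H ^ 2 := by ring
  -- `cE⁻² H⁻² ≤ ε`
  have hεge : (cE ^ 2)⁻¹ * H ^ (-(2 : ℝ)) ≤ ε := by
    have hpos : 0 < cE ^ 2 * H ^ 2 := by positivity
    have h1 : (cE ^ 2 * H ^ 2)⁻¹ ≤ ε := inv_le_of_inv_le₀ hε0 hinv
    rw [Real.rpow_neg hH0.le, ← mul_inv, show H ^ (2 : ℝ) = H ^ 2 by norm_cast]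
    exact h1
  have hkey : 2 * Real.pi * (cE ^ 2)⁻¹ * H ^ (-(2 : ℝ)) * ∑ σ, ((x σ).trace).re ≤ 2 * Real.pi * ε * ∑ σ, ((x σ).trace).re := by
    have h2 : 2 * Real.pi * ((cE ^ 2)⁻¹ * H ^ (-(2 : ℝ))) ≤ 2 * Real.pi * ε := mul_le_mul_of_nonneg_left hεge (by positivity)
    calc 2 * Real.pi * (cE ^ 2)⁻¹ * H ^ (-(2 : ℝ)) * ∑ σ, ((x σ).trace).re = (2 * Real.pi * ((cE ^ 2)⁻¹ * H ^ (-(2 : ℝ)))) * ∑ σ, ((x σ).trace).re := by ring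
      _ ≤ (2 * Real.pi * ε) * ∑ σ, ((x σ).trace).re := mul_le_mul_of_nonneg_right h2 hsum0
  linarith

/-- **… against any size `τ ≤ Σ_σ Re tr x_σ`** (for the TOP's `τ S`: the embedded entries of a positive index are below its traces):
`∏_σ e^{−2π Re tr(x_σ · y_σ y_σᴴ)} ≤ e^{−c · ‖h‖^{−2} · τ}`. [cite: MoeglinWaldspurger1995, II.1.5] [cite: Shimura1997, §A3] -/
theorem decay_le_exp_neg_height_of_le [NeZero N] [Nonempty p] (hc : c ≠ 1) (w : S → {w : InfinitePlace E // IsComplex w}) (hw : ∀ σ, c • (w σ).1 = (w σ).1)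
    (r : p ⊕ p ≃ Fin N) (T Tinv : S → Matrix (p ⊕ p) (p ⊕ p) ℂ) (hT : ∀ σ, T σ * Tinv σ = 1) (hT' : ∀ σ, Tinv σ * T σ = 1)
    {M : ℝ} (hM : 1 ≤ M) (hTe : ∀ σ i j, ‖T σ i j‖ ≤ M) (hTe' : ∀ σ i j, ‖Tinv σ i j‖ ≤ M) :
    ∃ c₁ : ℝ, 0 < c₁ ∧ ∀ (h : (adelicGroupData F E c N J).Adelic) (y b d : S → Matrix p p ℂ) (κ κ' : S → Matrix (p ⊕ p) (p ⊕ p) ℂ),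
      (∀ σ, κ σ * κ' σ = 1) → (∀ σ, κ' σ * κ σ = 1) → (∀ σ i j, ‖κ σ i j‖ ≤ M) → (∀ σ i j, ‖κ' σ i j‖ ≤ M) →
      (∀ σ, T σ * Matrix.reindex r.symm r.symm
          ((((archAt F E c N J (w σ) (hw σ) hc (archPart F E c N J h) : archLocal E N J (w σ)) : GL (Fin N) ℂ) : Matrix (Fin N) (Fin N) ℂ)) *
          Tinv σ = Matrix.fromBlocks (y σ) (b σ) 0 (d σ) * κ σ) →
      ∀ x : S → Matrix p p ℂ, (∀ σ, (x σ).PosSemidef) → ∀ τ : ℝ, τ ≤ ∑ σ, ((x σ).trace).re →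
        ∏ σ, Real.exp (-(2 * Real.pi * ((x σ * (y σ * (y σ)ᴴ)).trace).re)) ≤
          Real.exp (-(c₁ * adelicHeightGL N E (adelicVal F E c N J h) ^ (-(2 : ℝ)) * τ)) := by
  obtain ⟨c₁, hc₁, hface⟩ := decay_le_exp_neg_height F E c N J hc w hw r T Tinv hT hT' hM hTe hTe'
  refine ⟨c₁, hc₁, fun h y b d κ κ' hκ hκ' hκe hκe' hdec x hx τ hτ => (hface h y b d κ κ' hκ hκ' hκe hκe' hdec x hx).trans ?_⟩
  rw [Real.exp_le_exp]
  have hH0 : 0 ≤ adelicHeightGL N E (adelicVal F E c N J h) ^ (-(2 : ℝ)) := Real.rpow_nonneg (adelicHeightGL_nonneg _) _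
  nlinarith [mul_nonneg hc₁.le hH0]

end Face

end Summit.HodgeConjecture.HodgeConjecture.Cruxes.HLiu418.K2LiuSiegelEisensteinKindWArchDecay

end
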